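import Summits.KontsevichZagierPeriods.KontsevichZagierPeriods.Theorems.LinRedNormalFormArrangementNormalFormStubRebaseSimpleZeroNestedDiffPar
import Summits.KontsevichZagierPeriods.KontsevichZagierPeriods.Theorems.LinRedNormalFormArrangementNormalFormStubRebaseSimpleZeroTwoInterval

/-!
# Stub `stub_rebaseSimpleZeroTwo`, part `rebaseSimpleZero_nestedDifferent` (crux
`ArrangementNormalForm`, line `janus-bands`) — brick `NestedDiffGap`

Decidable sufficient conditions and the interval normal form. For a clean nest
`A(y) < tᵢ < tⱼ < B(y)` with the literal `GS 0 2` integrand (simple base pole `r = ℓ₂.2`, both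
fibres lettered) over a base cell on one side of the pole:
* `RebaseDiff.good_typeA_gap` — `B ∥ cⱼ` and the wall of the edge expansion of `tᵢ` (the letter
  line of `tᵢ` rotated to the slope `λⱼ` about `r`) keeps a POSITIVE DISTANCE `g` from the fibre
  `tᵢ` on the domain ⇒ good (the letter forms are bounded on the bounded domain, so the
  expansion is dominated with `C = P̄/g`; the letters are off the domain by absolute convergence);
* `RebaseDiff.good_typeB_gap` — `A ∥ cᵢ` and the wall of the edge expansion of `tⱼ` keeps a
  positive distance from `tⱼ` ⇒ good;
* `rebaseSimpleZero_nestedDiffPar1` (registered) — the doubly letter-parallel case in the exact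
  binder format of the interval normal form `HDiff₁` of the assembly
  (`rebaseSimpleZeroTwo_of_intervalGGset`): its sub-case `A` constant and `B ∥ cⱼ`.

References: M. Kontsevich, D. Zagier, *Periods* (2001), §1.2, rules (1a), (1b), (2).
-/

noncomputable section

open Set MeasureTheory MvPolynomial
open Literature.NumberTheory.Transcendental Literature.ModelTheory.ExponentialFields

namespace Summit.KontsevichZagierPeriods.ArrangementNormalForm.JanusBands

namespace RebaseDiff

open SeparatePos RebasePos RebaseZero RebaseNest

variable {m m' : ℕ} {i j : Fin 2}

/-- The letter forms are bounded on a bounded domain. -/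
theorem exists_letter_bound (s : KZ.IntegralRep (0 + 1 + 2)) (hbd : Bornology.IsBounded s.domain) (l : Fin 2)
    (c : Cf) : ∃ P : ℝ, 0 < P ∧ ∀ z ∈ s.domain, |tv z l - ev c (yv z)| ≤ P := by
  obtain ⟨Rb, hRb⟩ := hbd.exists_norm_le
  have hR0 : 0 ≤ max Rb 0 := le_max_right _ _
  refine ⟨max Rb 0 + (|(c.1 (Fin.last 0) : ℝ)| * max Rb 0 + |(c.2 : ℝ)|) + 1, by positivity, fun z hz => ?_⟩
  have hz1 : |tv z l| ≤ max Rb 0 :=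
    ((norm_le_pi_norm z (tIdx l)).trans ((hRb z hz).trans (le_max_left _ _)))
  have hz2 : |yv z| ≤ max Rb 0 :=
    ((norm_le_pi_norm z (yIdx 2)).trans ((hRb z hz).trans (le_max_left _ _)))
  have h3 : |ev c (yv z)| ≤ |(c.1 (Fin.last 0) : ℝ)| * |yv z| + |(c.2 : ℝ)| := by
    rw [ev]
    calc |(c.1 (Fin.last 0) : ℝ) * yv z + c.2| ≤ |(c.1 (Fin.last 0) : ℝ) * yv z| + |(c.2 : ℝ)| := abs_add_le _ _
      _ = |(c.1 (Fin.last 0) : ℝ)| * |yv z| + |(c.2 : ℝ)| := by rw [abs_mul]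
  have h4 : |(c.1 (Fin.last 0) : ℝ)| * |yv z| ≤ |(c.1 (Fin.last 0) : ℝ)| * max Rb 0 :=
    mul_le_mul_of_nonneg_left hz2 (abs_nonneg (c.1 (Fin.last 0) : ℝ))
  calc |tv z l - ev c (yv z)| ≤ |tv z l| + |ev c (yv z)| := abs_sub _ _
    _ ≤ max Rb 0 + (|(c.1 (Fin.last 0) : ℝ)| * max Rb 0 + |(c.2 : ℝ)|) + 1 := by linarith

/-- The base pole is off a domain whose base cell lies on one side of it. -/
theorem base_ne_of_side (hij : i ≠ j) (M : Fin m' → Cf) (A Bd : Cf) (r : ℚ)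
    (hside : (∀ y ∈ cell M, (r : ℝ) < y) ∨ (∀ y ∈ cell M, y < (r : ℝ))) :
    ∀ z ∈ gDom 0 2 m' M (nlo i A) (nhi j Bd), yv z ≠ r := fun z hz => by
  have hc : yv z ∈ cell M := ((mem_nDom hij M A Bd z).1 hz).1
  rcases hside with hs | hs
  · exact (hs _ hc).ne'
  · exact (hs _ hc).ne

/-- **Type A with a gap.** A clean nest with the literal `GS 0 2` integrand, `B ∥ cⱼ`, base
cell on one side of the pole, such that the wall of the edge expansion of `tᵢ` (the letter line
of `tᵢ` rotated to the slope `λⱼ` about the pole) keeps a positive distance `g` from `tᵢ` on the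
domain, is good for `GG 0 2 2`. [Kontsevich–Zagier 2001, §1.2] -/
theorem good_typeA_gap (s : KZ.IntegralRep (0 + 1 + 2)) (hij : i ≠ j) (M : Fin m' → Cf) (A Bd : Cf)
    (L : Fin m → (Fin 0 → ℚ) × ℚ) (e : Fin m → ℕ) (p : MvPolynomial (Fin 0) ℚ) (ℓ₁ ℓ₂ : (Fin 0 → ℚ) × ℚ)
    (n₁ n₂ : ℕ) (a : Fin 2 → Option Cf) (ci cj : Cf) (hi : a i = some ci) (hj : a j = some cj)
    (hB : Bd.1 (Fin.last 0) = cj.1 (Fin.last 0)) (h1 : n₁ = 0) (hn : n₂ = 1)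
    (hside : (∀ y ∈ cell M, (ℓ₂.2 : ℝ) < y) ∨ (∀ y ∈ cell M, y < (ℓ₂.2 : ℝ)))
    (hbd : Bornology.IsBounded s.domain) (hdom : s.domain = gDom 0 2 m' M (nlo i A) (nhi j Bd))
    (hint : EqOn s.integrand (glit 0 2 p L e ℓ₁ ℓ₂ n₁ n₂ a) s.domain) (g : ℝ) (hg : 0 < g)
    (hgap : ∀ z ∈ s.domain, g ≤ |tv z i - ev (rot ci (cj.1 (Fin.last 0)) ℓ₂.2) (yv z)|) : Good 2 (KZ.of s) := by
  set T : BData := ⟨m, L, e, ℓ₁, ℓ₂, n₁, n₂⟩ with hT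
  have hglit : glit 0 2 p L e ℓ₁ ℓ₂ n₁ n₂ a = glitB T p a := rfl
  by_cases hΔ : ci.1 (Fin.last 0) = cj.1 (Fin.last 0)
  · refine good_any s M L e p ℓ₁ ℓ₂ a (nlo i A) (nhi j Bd) h1 hn ⟨ci.1 (Fin.last 0), fun l c hc => ?_⟩ hbd hdom hint
    rcases fin_two_eq_or hij l with rfl | rfl
    · rw [hi] at hc; cases hc; rfl
    · rw [hj] at hc; cases hc; exact hΔ.symm
  by_cases hK : Kc T p = 0
  · refine RebaseZero.good_of_mem_relations (KZ.of_mem_relations_of_eqOn_zero s fun z hz => ?_)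
    rw [hint hz, hglit, Pi.zero_apply, glitB_eq_Kc, hK, zero_mul, zero_mul]
  have hIo : IntegrableOn (glitB T p a) (gDom 0 2 m' M (nlo i A) (nhi j Bd)) := by
    rw [← hdom, ← hglit]
    exact s.integrableOn.congr_fun hint (KZ.IntegralRep.measurableSet_domain_holds s)
  obtain ⟨hnei, -⟩ := letter_ne_of_integrableOn hij M A Bd T p a ci cj hi hj h1 hn hK hIo
  obtain ⟨P, hP, hPle⟩ := exists_letter_bound s hbd i ci
  rw [← hdom] at hnei
  refine good_typeA s hij M A Bd L e p ℓ₁ ℓ₂ n₁ n₂ a ci cj hi hj hB hΔ h1 hn hbd hdom hint hnei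
    (fun z hz => base_ne_of_side hij M A Bd ℓ₂.2 hside z (hdom ▸ hz)) (P / g) fun z hz => ?_
  calc |tv z i - ev ci (yv z)| ≤ P := hPle z hz
    _ = P / g * g := (div_mul_cancel₀ P hg.ne').symm
    _ ≤ P / g * |tv z i - ev (rot ci (cj.1 (Fin.last 0)) ℓ₂.2) (yv z)| :=
        mul_le_mul_of_nonneg_left (hgap z hz) (by positivity)

/-- **Type B with a gap.** A clean nest with the literal `GS 0 2` integrand, `A ∥ cᵢ`, base
cell on one side of the pole, such that the wall of the edge expansion of `tⱼ` (the letter line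
of `tⱼ` rotated to the slope `λᵢ` about the pole) keeps a positive distance `g` from `tⱼ` on the
domain, is good for `GG 0 2 2`. [Kontsevich–Zagier 2001, §1.2] -/
theorem good_typeB_gap (s : KZ.IntegralRep (0 + 1 + 2)) (hij : i ≠ j) (M : Fin m' → Cf) (A Bd : Cf)
    (L : Fin m → (Fin 0 → ℚ) × ℚ) (e : Fin m → ℕ) (p : MvPolynomial (Fin 0) ℚ) (ℓ₁ ℓ₂ : (Fin 0 → ℚ) × ℚ)
    (n₁ n₂ : ℕ) (a : Fin 2 → Option Cf) (ci cj : Cf) (hi : a i = some ci) (hj : a j = some cj)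
    (hA : A.1 (Fin.last 0) = ci.1 (Fin.last 0)) (h1 : n₁ = 0) (hn : n₂ = 1)
    (hside : (∀ y ∈ cell M, (ℓ₂.2 : ℝ) < y) ∨ (∀ y ∈ cell M, y < (ℓ₂.2 : ℝ)))
    (hbd : Bornology.IsBounded s.domain) (hdom : s.domain = gDom 0 2 m' M (nlo i A) (nhi j Bd))
    (hint : EqOn s.integrand (glit 0 2 p L e ℓ₁ ℓ₂ n₁ n₂ a) s.domain) (g : ℝ) (hg : 0 < g)
    (hgap : ∀ z ∈ s.domain, g ≤ |tv z j - ev (rot cj (ci.1 (Fin.last 0)) ℓ₂.2) (yv z)|) : Good 2 (KZ.of s) := by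
  set T : BData := ⟨m, L, e, ℓ₁, ℓ₂, n₁, n₂⟩ with hT
  have hglit : glit 0 2 p L e ℓ₁ ℓ₂ n₁ n₂ a = glitB T p a := rfl
  by_cases hΔ : ci.1 (Fin.last 0) = cj.1 (Fin.last 0)
  · refine good_any s M L e p ℓ₁ ℓ₂ a (nlo i A) (nhi j Bd) h1 hn ⟨ci.1 (Fin.last 0), fun l c hc => ?_⟩ hbd hdom hint
    rcases fin_two_eq_or hij l with rfl | rfl
    · rw [hi] at hc; cases hc; rfl
    · rw [hj] at hc; cases hc; exact hΔ.symm
  by_cases hK : Kc T p = 0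
  · refine RebaseZero.good_of_mem_relations (KZ.of_mem_relations_of_eqOn_zero s fun z hz => ?_)
    rw [hint hz, hglit, Pi.zero_apply, glitB_eq_Kc, hK, zero_mul, zero_mul]
  have hIo : IntegrableOn (glitB T p a) (gDom 0 2 m' M (nlo i A) (nhi j Bd)) := by
    rw [← hdom, ← hglit]
    exact s.integrableOn.congr_fun hint (KZ.IntegralRep.measurableSet_domain_holds s)
  obtain ⟨-, hnej⟩ := letter_ne_of_integrableOn hij M A Bd T p a ci cj hi hj h1 hn hK hIo
  obtain ⟨P, hP, hPle⟩ := exists_letter_bound s hbd j cj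
  rw [← hdom] at hnej
  refine good_typeB s hij M A Bd L e p ℓ₁ ℓ₂ n₁ n₂ a ci cj hi hj hA hΔ h1 hn hbd hdom hint hnej
    (fun z hz => base_ne_of_side hij M A Bd ℓ₂.2 hside z (hdom ▸ hz)) (P / g) fun z hz => ?_
  calc |tv z j - ev cj (yv z)| ≤ P := hPle z hz
    _ = P / g * g := (div_mul_cancel₀ P hg.ne').symm
    _ ≤ P / g * |tv z j - ev (rot cj (ci.1 (Fin.last 0)) ℓ₂.2) (yv z)| :=
        mul_le_mul_of_nonneg_left (hgap z hz) (by positivity)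

end RebaseDiff

/-- **Registered part `rebaseSimpleZero_nestedDiffPar1` of `rebaseSimpleZero_nestedDifferent` (stub
`stub_rebaseSimpleZeroTwo`, line `janus-bands`): the doubly letter-parallel sub-case of the interval
normal form `HDiff₁` of the assembly, closed.** In the binder format of the hypothesis `HDiff₁` of
`rebaseSimpleZeroTwo_of_intervalGGset` (clean nest `A(y) < tᵢ < tⱼ < B(y)` over the literal interval
`{l < y < u}`, inner letter `cᵢ` constant, outer letter `cⱼ` of non-zero `y`-slope, base pole
`ℓ₂.2` outside the open interval, literal `GS 0 2` integrand with exponents `0, 1`), under the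
two extra equations `A.1 (Fin.last 0) = 0` (the inner lower bound is constant, i.e. parallel to
the inner letter) and `B.1 (Fin.last 0) = cj.1 (Fin.last 0)` (the outer upper bound is parallel
to the outer letter), the representation is congruent modulo `KZ.relations` to the subgroup
generated by the literal rebased class `GG 0 2 2` (`RebaseDiff.good_par`). [Kontsevich–Zagier
2001, §1.2, rules (1a), (1b), (2)] -/
theorem rebaseSimpleZero_nestedDiffPar1 (m : ℕ) (s : KZ.IntegralRep (0 + 1 + 2)) (L : Fin m → (Fin 0 → ℚ) × ℚ) (e : Fin m → ℕ) (p : MvPolynomial (Fin 0) ℚ) (ℓ₁ ℓ₂ : (Fin 0 → ℚ) × ℚ) (a : Fin 2 → Option ((Fin (0 + 1) → ℚ) × ℚ)) (lo hi : Fin 2 → Fin 2 ⊕ ((Fin (0 + 1) → ℚ) × ℚ)) (i j : Fin 2) (A B ci cj : (Fin (0 + 1) → ℚ) × ℚ) (l u : ℚ) (hij : i ≠ j) (hloi : lo i = Sum.inr A) (hhii : hi i = Sum.inl j) (hloj : lo j = Sum.inl i) (hhij : hi j = Sum.inr B) (hai : a i = some ci) (haj : a j = some cj) (hci : ci.1 (Fin.last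 0) = 0) (hcj : cj.1 (Fin.last 0) ≠ 0) (hlu : l < u) (hAB : ∀ y : ℝ, (l : ℝ) < y → y < (u : ℝ) → RebaseZero.ev A y < RebaseZero.ev B y) (hpole : ℓ₂.2 ≤ l ∨ u ≤ ℓ₂.2) (hbd : Bornology.IsBounded s.domain) (hdom : s.domain = SeparatePos.gDom 0 2 2 ![RebaseZero.mk 1 (-l), RebaseZero.mk (-1) u] lo hi) (hint : EqOn s.integrand (RebasePos.glit 0 2 p L e ℓ₁ ℓ₂ 0 1 a) s.domain) (hA0 : A.1 (Fin.last 0) = 0) (hB : B.1 (Fin.last 0) = cj.1 (Fin.last 0)) : ∃ c ∈ AddSubgroup.closure (SeparatePos.GGset 0 2 2), KZ.of s - c ∈ KZ.relations := by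
  have _hunused : l < u ∧ (∀ y : ℝ, (l : ℝ) < y → y < (u : ℝ) → RebaseZero.ev A y < RebaseZero.ev B y) ∧
      cj.1 (Fin.last 0) ≠ 0 := ⟨hlu, hAB, hcj⟩
  obtain ⟨hlo, hhi⟩ := RebaseNest.eq_nlo_nhi hij hloi hhii hloj hhij
  subst hlo hhi
  refine RebaseDiff.good_par s hij _ A B L e p ℓ₁ ℓ₂ 0 1 a ci cj hai haj (by rw [hA0, hci]) hB rfl rfl ?_ hbd hdom hint
  rcases hpole with h | h
  · refine Or.inl fun y hy => ?_
    have h' : (ℓ₂.2 : ℝ) ≤ l := by exact_mod_cast h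
    exact h'.trans_lt ((RebaseNest.mem_cell_Ioo l u y).1 hy).1
  · refine Or.inr fun y hy => ?_
    have h' : (u : ℝ) ≤ ℓ₂.2 := by exact_mod_cast h
    exact ((RebaseNest.mem_cell_Ioo l u y).1 hy).2.trans_le h'

end Summit.KontsevichZagierPeriods.ArrangementNormalForm.JanusBands
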